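import Mathlib
import HarnessLib
import Summits.MatrixMultiplication.MatrixMultiplication.Theses.SnSubsetDichotomy
import Summits.MatrixMultiplication.MatrixMultiplication.Theorems.SnSubsetDichotomyHyperoctahedralSubsetsGroupPacking
import Summits.MatrixMultiplication.MatrixMultiplication.Theorems.SnSubsetDichotomyHyperoctahedralSubsetsPairwisePacking
import Summits.MatrixMultiplication.MatrixMultiplication.Theorems.SnSubsetDichotomyHyperoctahedralSubsetsHostSquare
import Summits.MatrixMultiplication.MatrixMultiplication.Theorems.SnSubsetDichotomyHyperoctahedralSubsetsCycleCount
import Summits.MatrixMultiplication.MatrixMultiplication.Theorems.SnSubsetDichotomyHyperoctahedralSubsetsTriplesToGroup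
import Summits.MatrixMultiplication.MatrixMultiplication.Theorems.SnSubsetDichotomyHyperoctahedralThresholdStubCycleGadget
import Summits.MatrixMultiplication.MatrixMultiplication.Theorems.SnSubsetDichotomyHyperoctahedralThresholdStubPathGadget
import Summits.MatrixMultiplication.MatrixMultiplication.Theorems.SnSubsetDichotomyHyperoctahedralThresholdStubMobiusGadget
import Summits.MatrixMultiplication.MatrixMultiplication.Theorems.SnSubsetDichotomyHyperoctahedralThresholdStubExtract
import Summits.MatrixMultiplication.MatrixMultiplication.Theorems.SnSubsetDichotomyHyperoctahedralThresholdStubPackGadgets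
import Summits.MatrixMultiplication.MatrixMultiplication.Theorems.SnSubsetDichotomyHyperoctahedralThresholdStubGoodTwin
import Summits.MatrixMultiplication.MatrixMultiplication.Theorems.SnSubsetDichotomyHyperoctahedralThresholdStubBadCount
import Summits.MatrixMultiplication.MatrixMultiplication.Theorems.SnSubsetDichotomyHyperoctahedralThresholdStubPatternTwin
import Summits.MatrixMultiplication.MatrixMultiplication.Theorems.SnSubsetDichotomyHyperoctahedralThresholdPoorOfRigid

/-!
# ¬`HyperoctahedralThreshold` (stmt-MatrixMultiplication-10883) — part 1/3: statements and the poor core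

Port to `Theorems/` of the registered refutation skeleton `Cruxes/HyperoctahedralThreshold/Lines/refutation_local_symmetry.lean`
(leads -0, c1–c4; every stub of which is now a TREE THEOREM — the last one, `stub_poorRigidCore`, landed as
`…Theorems.HyperoctahedralThreshold.stub_poorRigidCore`, p131375, by the stub-plan prover seat).  This file: the self-contained
statements (`def … : Prop`, verbatim from the skeleton) and the first glue step `poorCore_of : stub_patternTwin → stub_poorRigidCore →
stub_poorCore` with its helpers.  Parts 2/3: `…RefutationDescent.lean` (rich-word halving descent, one gadget, local triples, symmetry
budget) and `…Refutation.lean` (the sibling composition and `not_HyperoctahedralThreshold`).  Text of the glue is the skeleton's, unchanged.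
-/

-- the tree's namespace `Summit.MatrixMultiplication.MatrixMultiplication.…` repeats a component by design
set_option linter.dupNamespace false

namespace Summit.MatrixMultiplication.MatrixMultiplication.Theorems.HyperoctahedralThreshold.Refutation

open Literature.Combinatorics.Additive

/-! ## Statements (self-contained, so that Theorems-side `--supports` proofs can restate them verbatim) -/

/-! Throughout, "`(a, b)` is a commuting local triple for `μ`" is spelled
`a * a = 1 ∧ b * b = 1 ∧ a * b = b * a ∧ (a ≠ 1 ∨ b ≠ 1) ∧ a * μ 0 = μ 0 * a ∧ b * μ 1 = μ 1 * b ∧ a * b * μ 2 = μ 2 * (a * b)`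
(commuting involutions, not both trivial, `a ∈ C(μ 0)`, `b ∈ C(μ 1)`, `ab ∈ C(μ 2)`), followed by a clause locating the support. -/

/-- **Stub 1 · `stub_cycleGadget`** (provable now; size M).  CLEAN CYCLE of the rung graph ⇒ local triple.  Data: `k + 2` rungs
`{p i, q i}` (`i : Fin (k+2)`, cyclic), all `2(k+2)` points distinct (`p`, `q` injective with disjoint images), the step `i → i+1`
coloured `col i` moving both ends of rung `i` onto the ends of rung `i+1`, consecutive colours distinct; `μ c` involutions.
Claim: a commuting local triple supported on the points `p i, q i`.  Recipe: `τ := ∏ᵢ (p i  q i)`; `a := τ` restricted to the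
rungs `i` with `0 ∈ {col (i-1), col i}`, `b :=` the same with colour `1` (then `ab` is `τ` on the rungs seeing colour `2`, since every
rung sees exactly two colours); `a ∈ C(μ 0)` because an `M₀`-edge at a point of its support is a step of the cycle and goes to the twin
step.  Define `a, b` by `Function.Involutive.toPerm` of the explicit pointwise maps and check the identities pointwise (`Equiv.ext`).
[this line; sibling crux 8305 NOTES §2 (gadget/twin lemma)] -/
def stub_cycleGadget : Prop :=
  ∀ (n k : ℕ) (μ : Fin 3 → Equiv.Perm (Fin n)) (p q : Fin (k + 2) → Fin n) (col : Fin (k + 2) → Fin 3), (∀ c, μ c * μ c = 1) → Function.Injective p → Function.Injective q → (∀ i j, p i ≠ q j) → (∀ i, μ (col i) (p i) = p (i + 1) ∧ μ (col i) (q i) = q (i + 1)) → (∀ i, col i ≠ col (i + 1)) → ∃ a b : Equiv.Perm (Fin n), a * a = 1 ∧ b * b = 1 ∧ a * b = b * a ∧ (a ≠ 1 ∨ b ≠ 1) ∧ a * μ 0 = μ 0 * a ∧ b * μ 1 = μ 1 * b ∧ a * b * μ 2 = μ 2 * (a * b) ∧ (∀ v, (a v ≠ v ∨ b v ≠ v)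 → ∃ i, v = p i ∨ v = q i)

/-- **Stub 2 · `stub_pathGadget`** (provable now; size M).  CLEAN PATH of the rung graph between two loop-rungs ⇒ local triple
(reflection-symmetric cycles of `Γ`: double edge `k = 0`, bicoloured cycles, the rainbow square `0,2,1,2`, …).  Data: `k + 1` rungs
`{p j, q j}` (`j : Fin (k+1)`), all points distinct, and `k + 2` colour SLOTS `col : Fin (k+2) → Fin 3`: slot `0` is a loop at rung `0`
(`μ (col 0) (p 0) = q 0`), slot `j+1` (`j < k`) is the step from rung `j` to rung `j+1`, slot `k+1` is a loop at rung `k`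
(`μ (col (k+1)) (p k) = q k`); consecutive slots carry distinct colours.  Recipe as in Stub 1 with rung `j` seeing the colours of
slots `j` and `j+1` (a loop `μ_c` swaps the two ends of its rung, which commutes with the rung transposition). [this line] -/
def stub_pathGadget : Prop :=
  ∀ (n k : ℕ) (μ : Fin 3 → Equiv.Perm (Fin n)) (p q : Fin (k + 1) → Fin n) (col : Fin (k + 2) → Fin 3), (∀ c, μ c * μ c = 1) → Function.Injective p → Function.Injective q → (∀ i j, p i ≠ q j) → μ (col 0) (p 0) = q 0 → μ (col (Fin.last (k + 1))) (p (Fin.last k)) = q (Fin.last k) → (∀ j : Fin k, μ (col j.succ.castSucc) (p j.castSucc) = p j.succ ∧ μ (col j.succ.castSucc) (q j.castSucc) = q j.succ) → (∀ i : Fin (k + 1), col i.castSucc ≠ col i.succ) → ∃ a b : Equiv.Perm (Fin n), a * a = 1 ∧ b * b = 1 ∧ a * b = b * a ∧ (a ≠ 1 ∨ b ≠ 1) ∧ a * μ 0 = μ 0 * a ∧ b * μ 1 = μ 1 * b ∧ a * b * μ 2 = μ 2 * (a * b) ∧ (∀ v, (a v ≠ v ∨ b v ≠ v) → ∃ i,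 v = p i ∨ v = q i)

/-- **Stub 2b · `stub_mobiusGadget`** (provable now; size M).  CLEAN MÖBIUS CYCLE of the rung graph ⇒ local triple (antipodally
symmetric cycles of `Γ`, colour word `uu`: e.g. the bicoloured square).  Data: `k + 2` rungs `(p i, q i)`, `i : Fin (k+2)`, all points
distinct; for `j : Fin (k+1)` the step of colour `col j.castSucc` maps rung `j.castSucc` onto rung `j.succ` SIDE-PRESERVINGLY, and the closing
step of colour `col (Fin.last (k+1))` maps the last rung onto rung `0` with the two SIDES SWAPPED (`p last ↦ q 0`, `q last ↦ p 0`);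
consecutive step colours distinct, including the wrap.  Recipe as in Stub 1 (rung `i` sees the colours of the step into it and the step out
of it; the swap at the wrap is invisible to the rung transpositions). [this line] -/
def stub_mobiusGadget : Prop :=
  ∀ (n k : ℕ) (μ : Fin 3 → Equiv.Perm (Fin n)) (p q : Fin (k + 2) → Fin n) (col : Fin (k + 2) → Fin 3), (∀ c, μ c * μ c = 1) → Function.Injective p → Function.Injective q → (∀ i j, p i ≠ q j) → (∀ j : Fin (k + 1), μ (col j.castSucc) (p j.castSucc) = p j.succ ∧ μ (col j.castSucc) (q j.castSucc) = q j.succ) → μ (col (Fin.last (k + 1))) (p (Fin.last (k + 1))) = q 0 → μ (col (Fin.last (k + 1))) (q (Fin.last (k + 1))) = p 0 → (∀ i : Fin (k + 1), col i.castSucc ≠ col i.succ) → col (Fin.last (k + 1)) ≠ col 0 → ∃ a b : Equiv.Perm (Fin n), a * a = 1 ∧ b * b = 1 ∧ a * b = b * a ∧ (a ≠ 1 ∨ b ≠ 1) ∧ a * μ 0 = μ 0 * a ∧ b * μ 1 = μ 1 * b ∧ a * b * μ 2 = μ 2 * (a * b) ∧ (∀ v, (a v ≠ v ∨ b v ≠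 v) → ∃ i, v = p i ∨ v = q i)

/-- **Stub 3a · `stub_extract`** (provable now; size M–L).  EXTRACTION: a closed colour-walk of the rung graph — `k + 1` ordered rungs
`(p i, q i)` indexed cyclically by `Fin (k+1)`, `p i ≠ q i`, the step of colour `col i` mapping the SET `{p i, q i}` onto `{p (i+1), q (i+1)}`
(either side-preservingly or with the sides swapped; a "loop" `{p i, q i} = {p (i+1), q (i+1)}` is allowed), consecutive colours distinct
(cyclically), and any two rungs EQUAL (as sets) OR DISJOINT — for fixed-point-free involutions `μ c` — contains clean-cycle, clean-path or clean-Möbius data (Stubs 1, 2, 2b) whose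
points are among the walk's points and whose number of rungs is at most `k + 1`.  Proof (paper): if no rung repeats, relabel the sides
consistently along the walk (`p″ (i+1) := μ (col i) (p″ i)`); the wrap is then side-preserving (cycle) or swapping (Möbius).  Else take a
repetition `{p s, q s} = {p t, q t}`, `s < t`: gap 1 is a loop step; if there is no loop take the minimal gap `g ≥ 2` — the sub-walk `s…t` has
distinct rungs and is cyclically non-backtracking (`col (t−1) = col s` would force the repetition `(s+1, t−1)` of gap `g−2`: for `g ≥ 4`
smaller, for `g = 3` a loop, for `g = 2` it contradicts `col s ≠ col (s+1)`); if there are loops, cut the walk at its loops: a segment between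
consecutive loops with internally distinct rungs is clean-path data (zero steps = double edge), and a segment with an internal repetition
contains, by the same minimal-gap argument inside the segment, a clean cycle/Möbius. [this line] -/
def stub_extract : Prop :=
  ∀ (n k : ℕ) (μ : Fin 3 → Equiv.Perm (Fin n)) (p q : Fin (k + 1) → Fin n) (col : Fin (k + 1) → Fin 3), (∀ c, μ c * μ c = 1) → (∀ c v, μ c v ≠ v) → (∀ i, p i ≠ q i) → (∀ i, (μ (col i) (p i) = p (i + 1) ∧ μ (col i) (q i) = q (i + 1)) ∨ (μ (col i) (p i) = q (i + 1) ∧ μ (col i) (q i) = p (i + 1))) → (∀ i, col i ≠ col (i + 1)) → (∀ i j, (p i = p j ∧ q i = q j) ∨ (p i = q j ∧ q i = p j) ∨ (p i ≠ p j ∧ p i ≠ q j ∧ q i ≠ p j ∧ q i ≠ q j)) → (∃ (k' : ℕ) (p' q' : Fin (k' + 2) → Fin n) (col' : Fin (k' + 2) → Fin 3), Function.Injective p' ∧ Function.Injective q' ∧ (∀ i j, p' i ≠ q' j) ∧ (∀ i, μ (col' i) (p' i) = p' (i + 1) ∧ μ (col' i) (q' i) = q' (i + 1)) ∧ (∀ i,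 col' i ≠ col' (i + 1)) ∧ (∀ i, (∃ j, p' i = p j ∨ p' i = q j) ∧ (∃ j, q' i = p j ∨ q' i = q j)) ∧ k' + 2 ≤ k + 1) ∨ (∃ (k' : ℕ) (p' q' : Fin (k' + 1) → Fin n) (col' : Fin (k' + 2) → Fin 3), Function.Injective p' ∧ Function.Injective q' ∧ (∀ i j, p' i ≠ q' j) ∧ μ (col' 0) (p' 0) = q' 0 ∧ μ (col' (Fin.last (k' + 1))) (p' (Fin.last k')) = q' (Fin.last k') ∧ (∀ j : Fin k', μ (col' j.succ.castSucc) (p' j.castSucc) = p' j.succ ∧ μ (col' j.succ.castSucc) (q' j.castSucc) = q' j.succ) ∧ (∀ i : Fin (k' + 1), col' i.castSucc ≠ col' i.succ) ∧ (∀ i, (∃ j, p' i = p j ∨ p' i = q j) ∧ (∃ j, q' i = p j ∨ q' i = q j)) ∧ k' + 1 ≤ k + 1) ∨ (∃ (k' : ℕ) (p' q' : Fin (k' + 2) → Fin n) (col' : Fin (k' + 2) → Fin 3), Function.Injective p' ∧ Function.Injective q' ∧ (∀ i j, p' i ≠ q' j) ∧ (∀ j : Fin (k' + 1), μ (col' j.castSucc)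 (p' j.castSucc) = p' j.succ ∧ μ (col' j.castSucc) (q' j.castSucc) = q' j.succ) ∧ μ (col' (Fin.last (k' + 1))) (p' (Fin.last (k' + 1))) = q' 0 ∧ μ (col' (Fin.last (k' + 1))) (q' (Fin.last (k' + 1))) = p' 0 ∧ (∀ i : Fin (k' + 1), col' i.castSucc ≠ col' i.succ) ∧ col' (Fin.last (k' + 1)) ≠ col' 0 ∧ (∀ i, (∃ j, p' i = p j ∨ p' i = q j) ∧ (∃ j, q' i = p j ∨ q' i = q j)) ∧ k' + 2 ≤ k + 1)

/-- **Stub 3 · `stub_cleanWalk`** — THE OPEN CORE (held by the lead), in its weakest useful form: for all large `n`, three fixed-point-free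
involutions of `Fin n` and a forbidden set `R` with `|R| ≤ n^{3/4}` admit a closed colour-walk of the rung graph (as in Stub 3a: `k + 1` rungs,
steps as sets, cyclically non-backtracking, rungs pairwise equal-or-disjoint) with `k + 1 ≤ n^{1/4}` all of whose points avoid `R`.  Known
(paper): closed colour-walks of the rung graph and reflection incidences of length `≤ 4 log₂ n + O(1)` avoiding `R` always exist (pigeonhole on
words acting on pairs / on `≥ n` transported matchings `M_c·w`, else a relator); words with `≥ n^{3/4+o(1)}` fixed points ("rich") yield clean
twin cycles by a halving descent; vertex-transitive hosts, hosts with a relator of length `O(log n)`, hosts with a large view class /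
automorphism orbit, cyclic covers of good hosts, and random hosts satisfy it.  Open: equal-or-disjointness in the "poor-rigid" regime (see the
lead's research notes, `Cruxes/HyperoctahedralThreshold/NOTES.md`).  WHY IT MIGHT FAIL: a host family all of whose closed colour-walks shorter
than `n^{1/4}` have a pair of rungs sharing exactly one point (none known; odd cyclic covers delay clean walks only by a factor 3). -/
def stub_cleanWalk : Prop :=
  ∃ n₀ : ℕ, ∀ n ≥ n₀, ∀ μ : Fin 3 → Equiv.Perm (Fin n), (∀ i, μ i * μ i = 1 ∧ ∀ v, μ i v ≠ v) → ∀ R : Finset (Fin n), (R.card : ℝ) ≤ (n : ℝ) ^ ((3 : ℝ) / 4) → ∃ (k : ℕ) (p q : Fin (k + 1) → Fin n) (col : Fin (k + 1) → Fin 3), (∀ i, p i ≠ q i) ∧ (∀ i, (μ (col i) (p i) = p (i + 1) ∧ μ (col i) (q i) = q (i + 1)) ∨ (μ (col i) (p i) = q (i + 1) ∧ μ (col i) (q i) = p (i + 1))) ∧ (∀ i, col i ≠ col (i + 1)) ∧ (∀ i j, (p i = p j ∧ q i = q j) ∨ (p i = q j ∧ q i = p j) ∨ (p i ≠ p j ∧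 p i ≠ q j ∧ q i ≠ p j ∧ q i ≠ q j)) ∧ (∀ i, p i ∉ R ∧ q i ∉ R) ∧ ((k : ℝ) + 1) ≤ (n : ℝ) ^ ((1 : ℝ) / 4)

/-! ### Reshaping of the open core (lead c1, 2026-08-16): `stub_cleanWalk ⇐ stub_goodTwin ∧ stub_badCount ∧ stub_poorCore`.
Words are `z : List (Fin 3)` acting on the right, `x · z = z.foldl (fun v c => μ c v) x`; `z` is CYCLICALLY REDUCED when
`List.IsChain (· ≠ ·) (z ++ z)` (consecutive letters distinct, also across the wrap; forces `2 ≤ z.length` once `z ≠ []`);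
the trajectory of `x` is `t ↦ x · (z.take t)`, `t : Fin z.length`; `x` is a fixed point when `x · z = x`, GOOD when moreover its
trajectory is injective (the closed walk reading `z` from `x` is a simple cycle).  Threshold of the rich-word descent:
`A ℓ r := (4ℓ²)^(⌊log₂ ℓ⌋ + 1) · (r + 1)` (inlined; `= n^{3/4+o(1)}` for `ℓ = O(log n)`, `r = |R| ≤ n^{3/4}`). -/

/-- **Stub 3b · `stub_goodTwin`** (provable now; size M).  TWO GOOD FIXED POINTS GIVE A CLEAN TWIN.  If a cyclically reduced word
`z` of length `ℓ ≥ 2` has `m ≥ ℓ·|R| + ℓ² + 2` distinct GOOD fixed points `x i` (injective trajectories), then two of them have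
vertex-disjoint trajectories avoiding `R`, i.e. clean-cycle data (format of Stub 1) with `k + 2 = ℓ` rungs all of whose points avoid `R`.
Proof: for each position `t` the map `x ↦ x·(z.take t)` is injective, so at most `ℓ·|R|` of the `x i` have a trajectory point in `R`;
fix one of the remaining ones, `x i₁`; an index `j` CONFLICTS with `i₁` if `x j · z.take t = x i₁ · z.take s` for some `s, t` — for each
`(s, t)` at most one `j`, so at most `ℓ²` conflicts (including `j = i₁`); pick a non-conflicting `R`-free `i₂`.  Output `p t := x i₁ · z.take t`,
`q t := x i₂ · z.take t`, `col t := z[t]` (transport `Fin (k+2) = Fin ℓ` along `k := ℓ − 2`); the step identities are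
`foldl` over `take (t+1) = take t ++ [z[t]]` and, at the wrap, the fixed-point equation; `col t ≠ col (t+1)` (cyclically) is
`IsChain (· ≠ ·) (z ++ z)`. [this line, lead c1; NOTES §3 (rich words)] -/
def stub_goodTwin : Prop :=
  ∀ (n : ℕ) (μ : Fin 3 → Equiv.Perm (Fin n)) (R : Finset (Fin n)) (z : List (Fin 3)) (m : ℕ) (x : Fin m → Fin n), (∀ c, μ c * μ c = 1) → 2 ≤ z.length → List.IsChain (· ≠ ·) (z ++ z) → Function.Injective x → (∀ i, z.foldl (fun v c => μ c v) (x i) = x i) → (∀ i, Function.Injective (fun t : Fin z.length => (z.take (t : ℕ)).foldl (fun v c => μ c v) (x i))) → z.length * R.card + z.length ^ 2 + 2 ≤ m → ∃ (k : ℕ) (p q : Fin (k + 2) → Fin n) (col : Fin (k + 2) → Fin 3), Function.Injective p ∧ Function.Injective q ∧ (∀ i j, p i ≠ q j) ∧ (∀ i, μ (col i) (p i) = p (i + 1) ∧ μ (col i) (q i) = q (i + 1)) ∧ (∀ i, col i ≠ col (i + 1)) ∧ (∀ i, p i ∉ R ∧ q i ∉ R) ∧ k + 2 = z.length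

/-- **Stub 3c · `stub_badCount`** (provable now; size M–L).  BAD FIXED POINTS COME FROM SHORT RICH SUBWORDS.  Let `z` be cyclically
reduced of length `ℓ ≥ 2` for fixed-point-free involutions `μ c`, and suppose every cyclically reduced `τ ≠ []` with `2|τ| ≤ ℓ` has at
most `M` fixed points.  Then `z` has at most `C(ℓ,2)·M` distinct BAD fixed points (fixed points with a non-injective trajectory).
Proof: a bad `x` has `x·z.take s = x·z.take t =: p` for some `s < t < ℓ`; then `p` is fixed by the subword `σ = z[s,t)` (length `t−s`)
AND by its cyclic complement `σ' = z.drop t ++ z.take s` (use `x·z = x`); one of the two, call it `τ₀`, has `2|τ₀| ≤ ℓ`; `τ₀` is reduced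
(a cyclic factor of `z`), and stripping equal end letters `τ₀ = a τ₁ a` (fixed points correspond under `y ↦ μ a y`) ends at a cyclically
reduced `τ` of length `≥ 2` with the same number of fixed points — or at a single letter / at `t = s+1`, impossible since `μ c` has no
fixed point.  Charging `x ↦ (s,t)` and using injectivity of `x ↦ x·z.take s` bounds each fibre by `|Fix τ| ≤ M`. [this line, lead c1] -/
def stub_badCount : Prop :=
  ∀ (n : ℕ) (μ : Fin 3 → Equiv.Perm (Fin n)) (z : List (Fin 3)) (M m : ℕ) (x : Fin m → Fin n), (∀ c, μ c * μ c = 1) → (∀ c v, μ c v ≠ v) → 2 ≤ z.length → List.IsChain (· ≠ ·) (z ++ z) → (∀ τ : List (Fin 3), τ ≠ [] → 2 * τ.length ≤ z.length → List.IsChain (· ≠ ·) (τ ++ τ) → ∀ (m' : ℕ) (y : Fin m' → Fin n), Function.Injective y → (∀ i, τ.foldl (fun v c => μ c v) (y i) = y i) → m' ≤ M) → Function.Injective x → (∀ i, z.foldl (fun v c => μ c v) (x i) = x i) → (∀ i, ¬ Function.Injective (fun t : Fin z.length => (z.take (t : ℕ)).foldl (fun v c => μ c v) (x i))) → m ≤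 z.length.choose 2 * M

/-- **Stub 3d · `stub_poorCore`** — THE OPEN CORE after the reshape (held by the lead): the one-clean-walk statement `stub_cleanWalk`
UNDER THE POORNESS HYPOTHESIS that no cyclically reduced word `z` of length `≤ n^{1/4}` has more than `A |z| |R| = (4|z|²)^(⌊log₂|z|⌋+1)·(|R|+1)`
distinct fixed points (for `|z| = O(log n)` this is `n^{3/4+o(1)}`: the "poor" regime; richer words are handled by the descent `richDescent`
from Stubs 3b–3c, both LANDED: p99339, p98890).  STATE OF KNOWLEDGE (crux NOTES §§9–11): supplies are forced (`≥ n+1` reflection incidences per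
vertex by pigeonhole; `≥ 2^{ℓ−2}` based closed twin-type walks of the rung graph at `ℓ = 4 log₂ n + 6` by Kotani–Sunada on the pair graph); with the
rotation and bijection tricks, SELF-type defects cost only poorness × a dense-spot factor, and the whole union-bound count misses by a factor
`16 ℓ² D_T` ONLY through SLIDES (a fixed point `y` of `b` whose own trajectory point `y·m_j` is again fixed by `b`); so the residual input is the
weak-mixing statement (WM) `E_{(y,b)} #{j : y·m_j ∈ Fix b} ≤ 1/(16 ℓ D_T)` (generic value `≈ 2.6 ℓ/n`, measured), or a structure lemma for its
failure: ¬(WM) at offsets `j = O(log log n)` forces a rich commutator word (done on paper), near-automorphism traps of the pair graph are harmless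
(done on paper); ¬(WM) at mid-range offsets and cover-like traps are OPEN.  WHY IT MIGHT FAIL: a poor host family violating (WM) at mid-range offsets
without local structure — none known; annealed ¬(WM) hosts exist at n ≈ 100 but are gadget-RICH (4-cycles, hot rungs), and gadget-minimising
annealing leaves ≥ 50 clean reflection structures at every vertex (n = 96–128). -/
def stub_poorCore : Prop :=
  ∃ n₀ : ℕ, ∀ n ≥ n₀, ∀ μ : Fin 3 → Equiv.Perm (Fin n), (∀ i, μ i * μ i = 1 ∧ ∀ v, μ i v ≠ v) → ∀ R : Finset (Fin n), (R.card : ℝ) ≤ (n : ℝ) ^ ((3 : ℝ) / 4) → (∀ z : List (Fin 3), z ≠ [] → List.IsChain (· ≠ ·) (z ++ z) → (z.length : ℝ) ≤ (n : ℝ) ^ ((1 : ℝ) / 4) → ∀ (m : ℕ) (x : Fin m → Fin n), Function.Injective x → (∀ i, z.foldl (fun v c => μ c v) (x i) = x i) → m ≤ (4 * z.length ^ 2) ^ (Nat.log 2 z.length + 1) * (R.card + 1)) → ∃ (k : ℕ) (p q : Fin (k + 1) → Fin n) (col : Fin (k + 1) → Fin 3), (∀ i, p i ≠ q i) ∧ (∀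 i, (μ (col i) (p i) = p (i + 1) ∧ μ (col i) (q i) = q (i + 1)) ∨ (μ (col i) (p i) = q (i + 1) ∧ μ (col i) (q i) = p (i + 1))) ∧ (∀ i, col i ≠ col (i + 1)) ∧ (∀ i j, (p i = p j ∧ q i = q j) ∨ (p i = q j ∧ q i = p j) ∨ (p i ≠ p j ∧ p i ≠ q j ∧ q i ≠ p j ∧ q i ≠ q j)) ∧ (∀ i, p i ∉ R ∧ q i ∉ R) ∧ ((k : ℝ) + 1) ≤ (n : ℝ) ^ ((1 : ℝ) / 4)

/-! ### Peeling the core (lead c2, 2026-08-16): `stub_poorCore ⇐ stub_patternTwin ∧ stub_poorRigidCore`.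
A family of fixed points `x i` of a cyclically reduced word `z` has PAIRWISE IDENTICAL SELF-COINCIDENCE PATTERNS when
`x i · z.take s = x i · z.take t ↔ x j · z.take s = x j · z.take t` for all `i j s t` — e.g. any two vertices with equal
`2|z|`-views (`Stab ∩ Ball`), in particular two vertices in one colour-automorphism orbit (crux NOTES §3 "big view classes"),
or any family of GOOD fixed points (all patterns empty: Stub 3b is the special case).  Such a family of size `≥ 2ℓ|R| + ℓ² + 2`
contains two members whose trajectories avoid `R` and never cross, and then the rung walk `t ↦ {x i₁ · z.take t, x i₂ · z.take t}`
is a closed colour-walk of the rung graph with pairwise EQUAL-OR-DISJOINT rungs (equal exactly at the common self-coincidences):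
clean-walk data in the format of the core's conclusion, of `ℓ` rungs.  The residual core `stub_poorRigidCore` may therefore assume
that every pattern class of every short word is small ("rigid"), on top of poorness. -/

/-- **Stub 3e · `stub_patternTwin`** (provable now; size M — template: the landed `stub_goodTwin`, p99339, whose helper lemmas
`GoodTwin.foldl_take_step`, `GoodTwin.cyclic_ne`, `GoodTwin.foldl_injective` apply verbatim).  TWO FIXED POINTS WITH IDENTICAL
SELF-COINCIDENCE PATTERNS GIVE A CLEAN CLOSED RUNG WALK.  Data: `z` cyclically reduced of length `ℓ ≥ 2`, `μ c` involutions, an injective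
family `x : Fin m → Fin n` of fixed points of `z` with pairwise identical patterns, `m ≥ 2ℓ|R| + ℓ² + 2`.  Claim: clean-walk data
`(k, p, q, col)` with `k + 1 = ℓ`: `p t := x i₁ · z.take t`, `q t := x i₂ · z.take t`, `col t := z[t]`, all points outside `R`.
Proof: for each `t` the map `i ↦ x i · z.take t` is injective (a fixed word acts as a bijection), so at most `ℓ|R|` indices have a
trajectory point in `R`; pick such an `R`-free `i₁`; an index `i₂` CROSSES `i₁` if `x i₂ · z.take t = x i₁ · z.take s` for some `s t`
— at most one `i₂` per `(s,t)`, so at most `ℓ²` (including `i₂ = i₁`); pick an `R`-free non-crossing `i₂`.  Then `p t ≠ q t`;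
the steps are side-preserving (`foldl` over `take (t+1) = take t ++ [z[t]]`, and the fixed-point equation at the wrap);
`col t ≠ col (t+1)` cyclically is `IsChain (· ≠ ·) (z ++ z)`; and for rungs `s, t`: if `p s = p t` then `q s = q t` (identical
patterns) — EQUAL —, else `q s ≠ q t` too and the two cross-inequalities hold by the choice of `i₂` — DISJOINT. [this line, lead c2] -/
def stub_patternTwin : Prop :=
  ∀ (n : ℕ) (μ : Fin 3 → Equiv.Perm (Fin n)) (R : Finset (Fin n)) (z : List (Fin 3)) (m : ℕ) (x : Fin m → Fin n), (∀ c, μ c * μ c = 1) → 2 ≤ z.length → List.IsChain (· ≠ ·) (z ++ z) → Function.Injective x → (∀ i, z.foldl (fun v c => μ c v) (x i) = x i) → (∀ i j, ∀ s t : Fin z.length, ((z.take (s : ℕ)).foldl (fun v c => μ c v) (x i) = (z.take (t : ℕ)).foldl (fun v c => μ c v) (x i) ↔ (z.take (s : ℕ)).foldl (fun v c => μ c v) (x j) = (z.take (t : ℕ)).foldl (fun v c => μ c v) (x j))) → 2 * (z.length * R.card) + z.length ^ 2 + 2 ≤ m → ∃ (k : ℕ) (p q : Fin (k + 1) → Fin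 n) (col : Fin (k + 1) → Fin 3), (∀ i, p i ≠ q i) ∧ (∀ i, (μ (col i) (p i) = p (i + 1) ∧ μ (col i) (q i) = q (i + 1)) ∨ (μ (col i) (p i) = q (i + 1) ∧ μ (col i) (q i) = p (i + 1))) ∧ (∀ i, col i ≠ col (i + 1)) ∧ (∀ i j, (p i = p j ∧ q i = q j) ∨ (p i = q j ∧ q i = p j) ∨ (p i ≠ p j ∧ p i ≠ q j ∧ q i ≠ p j ∧ q i ≠ q j)) ∧ (∀ i, p i ∉ R ∧ q i ∉ R) ∧ k + 1 = z.length

/-- **Stub 3f · `stub_poorRigidCore`** — THE OPEN CORE after the second peel (held by the lead): `stub_poorCore` under the additional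
RIGIDITY hypothesis that for every cyclically reduced word `z` with `|z| ≤ n^{1/4}` every injective family of fixed points of `z` with
pairwise identical self-coincidence patterns has at most `2|z||R| + |z|² + 1` members (bigger families are discharged by Stub 3e).
Rigidity excludes, besides rich words (poorness), large view classes and large colour-automorphism orbits at depth `2|z|`; the residual
regime is the "poor and rigid" one of crux NOTES §§4, 9–13, whose atom is the pair-correlation / agreement-propagation statement (AP).
WHY IT MIGHT FAIL: as for `stub_poorCore` — a poor rigid host family all of whose closed rung walks shorter than `n^{1/4}` avoiding some
`|R| ≤ n^{3/4}` have two rungs sharing exactly one point; none known. -/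
def stub_poorRigidCore : Prop :=
  ∃ n₀ : ℕ, ∀ n ≥ n₀, ∀ μ : Fin 3 → Equiv.Perm (Fin n), (∀ i, μ i * μ i = 1 ∧ ∀ v, μ i v ≠ v) → ∀ R : Finset (Fin n), (R.card : ℝ) ≤ (n : ℝ) ^ ((3 : ℝ) / 4) → (∀ z : List (Fin 3), z ≠ [] → List.IsChain (· ≠ ·) (z ++ z) → (z.length : ℝ) ≤ (n : ℝ) ^ ((1 : ℝ) / 4) → ∀ (m : ℕ) (x : Fin m → Fin n), Function.Injective x → (∀ i, z.foldl (fun v c => μ c v) (x i) = x i) → m ≤ (4 * z.length ^ 2) ^ (Nat.log 2 z.length + 1) * (R.card + 1)) → (∀ z : List (Fin 3), z ≠ [] → List.IsChain (· ≠ ·) (z ++ z) → (z.length : ℝ) ≤ (n : ℝ) ^ ((1 : ℝ) / 4) → ∀ (m : ℕ) (x : Fin m → Fin n), Function.Injective x → (∀ i, z.foldl (fun v c => μ c v) (x i) = x i) → (∀ i j, ∀ s t : Fin z.length, ((z.take (s : ℕ)).foldl (fun v c => μ c v) (x i) = (z.take (t : ℕ)).foldl (fun v c => μ c v) (x i) ↔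 (z.take (s : ℕ)).foldl (fun v c => μ c v) (x j) = (z.take (t : ℕ)).foldl (fun v c => μ c v) (x j))) → m ≤ 2 * (z.length * R.card) + z.length ^ 2 + 1) → ∃ (k : ℕ) (p q : Fin (k + 1) → Fin n) (col : Fin (k + 1) → Fin 3), (∀ i, p i ≠ q i) ∧ (∀ i, (μ (col i) (p i) = p (i + 1) ∧ μ (col i) (q i) = q (i + 1)) ∨ (μ (col i) (p i) = q (i + 1) ∧ μ (col i) (q i) = p (i + 1))) ∧ (∀ i, col i ≠ col (i + 1)) ∧ (∀ i j, (p i = p j ∧ q i = q j) ∨ (p i = q j ∧ q i = p j) ∨ (p i ≠ p j ∧ p i ≠ q j ∧ q i ≠ p j ∧ q i ≠ q j)) ∧ (∀ i, p i ∉ R ∧ q i ∉ R) ∧ ((k : ℝ) + 1) ≤ (n : ℝ) ^ ((1 : ℝ) / 4)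

/-- The ONE-GADGET statement: for large `n`, every forbidden set of size `≤ n^{3/4}` is avoided by the support `P` of some commuting
local triple, `|P| ≤ 2 n^{1/4}`.  (Proved below from Stubs 1–3: `oneGadget_of`.) -/
def OneGadget : Prop :=
  ∃ n₀ : ℕ, ∀ n ≥ n₀, ∀ μ : Fin 3 → Equiv.Perm (Fin n), (∀ i, μ i * μ i = 1 ∧ ∀ v, μ i v ≠ v) → ∀ R : Finset (Fin n), (R.card : ℝ) ≤ (n : ℝ) ^ ((3 : ℝ) / 4) → ∃ (a b : Equiv.Perm (Fin n)) (P : Finset (Fin n)), (a * a = 1 ∧ b * b = 1 ∧ a * b = b * a ∧ (a ≠ 1 ∨ b ≠ 1) ∧ a * μ 0 = μ 0 * a ∧ b * μ 1 = μ 1 * b ∧ a * b * μ 2 = μ 2 * (a * b) ∧ ∀ v, (a v ≠ v ∨ b v ≠ v) → v ∈ P) ∧ Disjoint P R ∧ (P.card : ℝ) ≤ 2 * (n : ℝ) ^ ((1 : ℝ) / 4)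

/-- The sibling skeleton's residual `stub_localTriples` (crux 8305, line `spherical-rank-sieve`), verbatim. -/
def LocalTriples : Prop :=
  ∃ x : ℝ, 0 < x ∧ ∃ c : ℝ, 0 < c ∧ ∃ n₀ : ℕ, ∀ n ≥ n₀, ∀ μ : Fin 3 → Equiv.Perm (Fin n), (∀ i, μ i * μ i = 1 ∧ ∀ v, μ i v ≠ v) → (∀ i j : Fin 3, i ≠ j → ∃ k ∈ (μ i * μ j).cycleType, x * Real.sqrt (n : ℝ) ≤ (k : ℝ)) → ∃ (g : ℕ) (a b : Fin g → Equiv.Perm (Fin n)), c * Real.sqrt (n : ℝ) ≤ (g : ℝ) ∧ (∀ j, a j * a j = 1 ∧ b j * b j = 1 ∧ a j * b j = b j * a j ∧ (a j ≠ 1 ∨ b j ≠ 1) ∧ a j * μ 0 = μ 0 * a j ∧ b j * μ 1 = μ 1 * b j ∧ a j * b j * μ 2 = μ 2 * (a j * b j)) ∧ (∀ j j' : Fin g, j ≠ j' → ∀ v, (a j v ≠ v ∨ b j v ≠ v) → a j' v = v ∧ b j' v = v)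

/-- The sibling's bridge `stub_triplesToGroup`, verbatim — LANDED in the tree as
`…Theorems.HyperoctahedralSubsets.stub_triplesToGroup` (p79923, file `SnSubsetDichotomyHyperoctahedralSubsetsTriplesToGroup.lean`);
taken as a (closed) stub here only because the farm has not yet built that module for import; replace `Stub.stub_triplesToGroup` by
the import when it has. -/
def TriplesToGroup : Prop :=
  ∀ (n : ℕ) (μ : Fin 3 → Equiv.Perm (Fin n)) (g : ℕ) (a b : Fin g → Equiv.Perm (Fin n)),
    (∀ j, a j * a j = 1 ∧ b j * b j = 1 ∧ a j * b j = b j * a j ∧ (a j ≠ 1 ∨ b j ≠ 1) ∧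
      a j * μ 0 = μ 0 * a j ∧ b j * μ 1 = μ 1 * b j ∧ a j * b j * μ 2 = μ 2 * (a j * b j)) →
    (∀ j j' : Fin g, j ≠ j' → ∀ v, (a j v ≠ v ∨ b j v ≠ v) → a j' v = v ∧ b j' v = v) →
    ∃ T : Finset (Equiv.Perm (Fin n) × Equiv.Perm (Fin n) × Equiv.Perm (Fin n)),
      (1 : Equiv.Perm (Fin n) × Equiv.Perm (Fin n) × Equiv.Perm (Fin n)) ∈ T ∧
      (∀ s ∈ T, ∀ t ∈ T, s * t ∈ T) ∧ (∀ t ∈ T, t⁻¹ ∈ T) ∧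
      (∀ t ∈ T, t.1 * μ 0 = μ 0 * t.1 ∧ t.2.1 * μ 1 = μ 1 * t.2.1 ∧ t.2.2 * μ 2 = μ 2 * t.2.2 ∧
        t.1 * t.2.1 * t.2.2 = 1) ∧
      2 ^ g ≤ T.card

/-- **Stub 4 · `stub_packGadgets`** (provable now; size M).  GREEDY PACKING: `OneGadget → LocalTriples` (both spelled out).  From the
one-gadget statement build, for `n ≥ n₀'`, `g = ⌈√n / 2⌉` support-disjoint commuting local triples by induction on the number placed,
taking as forbidden set `R` the union of the supports `P` placed so far (`|R| ≤ g · 2n^{1/4} ≤ n^{3/4}` once `n` is large); disjointness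
of the new support from `R` gives the pairwise-fixing clause.  This is `LocalTriples` with `x := 1` (long-cycle hypothesis unused) and
`c := 1/2`. [this line] -/
def stub_packGadgets : Prop :=
  (∃ n₀ : ℕ, ∀ n ≥ n₀, ∀ μ : Fin 3 → Equiv.Perm (Fin n), (∀ i, μ i * μ i = 1 ∧ ∀ v, μ i v ≠ v) → ∀ R : Finset (Fin n), (R.card : ℝ) ≤ (n : ℝ) ^ ((3 : ℝ) / 4) → ∃ (a b : Equiv.Perm (Fin n)) (P : Finset (Fin n)), (a * a = 1 ∧ b * b = 1 ∧ a * b = b * a ∧ (a ≠ 1 ∨ b ≠ 1) ∧ a * μ 0 = μ 0 * a ∧ b * μ 1 = μ 1 * b ∧ a * b * μ 2 = μ 2 * (a * b) ∧ ∀ v, (a v ≠ v ∨ b v ≠ v) → v ∈ P) ∧ Disjoint P R ∧ (P.card : ℝ) ≤ 2 * (n : ℝ) ^ ((1 : ℝ) / 4)) → (∃ x : ℝ, 0 < x ∧ ∃ c : ℝ, 0 < c ∧ ∃ n₀ : ℕ, ∀ n ≥ n₀, ∀ μ : Fin 3 → Equiv.Perm (Fin n), (∀ i, μ i * μ i = 1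 ∧ ∀ v, μ i v ≠ v) → (∀ i j : Fin 3, i ≠ j → ∃ k ∈ (μ i * μ j).cycleType, x * Real.sqrt (n : ℝ) ≤ (k : ℝ)) → ∃ (g : ℕ) (a b : Fin g → Equiv.Perm (Fin n)), c * Real.sqrt (n : ℝ) ≤ (g : ℝ) ∧ (∀ j, a j * a j = 1 ∧ b j * b j = 1 ∧ a j * b j = b j * a j ∧ (a j ≠ 1 ∨ b j ≠ 1) ∧ a j * μ 0 = μ 0 * a j ∧ b j * μ 1 = μ 1 * b j ∧ a j * b j * μ 2 = μ 2 * (a j * b j)) ∧ (∀ j j' : Fin g, j ≠ j' → ∀ v, (a j v ≠ v ∨ b j v ≠ v) → a j' v = v ∧ b j' v = v))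


/-! ## Glue (sorry-free) -/

/-- **Second peel of the core (lead c2)**: `stub_patternTwin ∧ stub_poorRigidCore ⇒ stub_poorCore` — if some short word has a large
pattern class, Stub 3e supplies the clean walk directly; otherwise the rigidity hypothesis of Stub 3f holds. -/
theorem poorCore_of (hP : stub_patternTwin) (hC : stub_poorRigidCore) : stub_poorCore := by
  obtain ⟨n₀, hC⟩ := hC
  refine ⟨n₀, fun n hn μ hμ R hR hpoor => ?_⟩
  by_cases hrig : ∀ z : List (Fin 3), z ≠ [] → List.IsChain (· ≠ ·) (z ++ z) → (z.length : ℝ) ≤ (n : ℝ) ^ ((1 : ℝ) / 4) → ∀ (m : ℕ) (x : Fin m → Fin n), Function.Injective x → (∀ i, z.foldl (fun v c => μ c v) (x i) = x i) → (∀ i j, ∀ s t : Fin z.length, ((z.take (s : ℕ)).foldl (fun v c => μ c v) (x i) = (z.take (t : ℕ)).foldl (fun v c => μ c v) (x i) ↔ (z.take (s : ℕ)).foldl (fun v c => μ c v) (x j) = (z.take (t : ℕ)).foldl (fun v c => μ c v) (x j))) → m ≤ 2 * (z.length * R.card) + z.length ^ 2 + 1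
  · exact hC n hn μ hμ R hR hpoor hrig
  · push Not at hrig
    obtain ⟨z, hz0, hzc, hzlen, m, x, hx, hfix, hpat, hm⟩ := hrig
    have hz2 : 2 ≤ z.length := PoorOfRigid.two_le_length_of_isChain hz0 hzc
    obtain ⟨k, p, q, col, h1, h2, h3, h4, h5, hk⟩ :=
      hP n μ R z m x (fun c => (hμ c).1) hz2 hzc hx hfix hpat (by omega)
    refine ⟨k, p, q, col, h1, h2, h3, h4, h5, ?_⟩
    have : ((k : ℝ) + 1) = (z.length : ℝ) := by exact_mod_cast hk
    rw [this]; exact hzlen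

/-- `|image p ∪ image q| ≤ 2 m` for `p q : Fin m → _`. -/
theorem card_image_union_le {n m : ℕ} (p q : Fin m → Fin n) :
    ((Finset.univ.image p ∪ Finset.univ.image q).card : ℝ) ≤ 2 * m := by
  have h1 : (Finset.univ.image p).card ≤ m := by
    simpa using (Finset.card_image_le (s := (Finset.univ : Finset (Fin m))) (f := p))
  have h2 : (Finset.univ.image q).card ≤ m := by
    simpa using (Finset.card_image_le (s := (Finset.univ : Finset (Fin m))) (f := q))
  have h3 := Finset.card_union_le (Finset.univ.image p) (Finset.univ.image q)
  have : ((Finset.univ.image p ∪ Finset.univ.image q).card : ℝ) ≤ (m : ℝ) + m := by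
    exact_mod_cast h3.trans (Nat.add_le_add h1 h2)
  linarith


/-- Points of extracted data lie among the walk's points: membership in `image p ∪ image q`. -/
theorem mem_image_union_of_among {n m m' : ℕ} (p q : Fin m → Fin n) (p' q' : Fin m' → Fin n)
    (h : ∀ i, (∃ j, p' i = p j ∨ p' i = q j) ∧ (∃ j, q' i = p j ∨ q' i = q j)) (v : Fin n)
    (hv : ∃ i, v = p' i ∨ v = q' i) : v ∈ Finset.univ.image p ∪ Finset.univ.image q := by
  obtain ⟨i, hi⟩ := hv
  simp only [Finset.mem_union, Finset.mem_image, Finset.mem_univ, true_and]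
  rcases hi with rfl | rfl
  · obtain ⟨j, hj | hj⟩ := (h i).1
    · exact Or.inl ⟨j, hj.symm⟩
    · exact Or.inr ⟨j, hj.symm⟩
  · obtain ⟨j, hj | hj⟩ := (h i).2
    · exact Or.inl ⟨j, hj.symm⟩
    · exact Or.inr ⟨j, hj.symm⟩

/-! ### Rich-word descent (lead c1): `stub_goodTwin ∧ stub_badCount ⇒` a word with more than `A ℓ |R|` fixed points yields a
clean `R`-avoiding twin cycle; with `stub_poorCore` this gives `stub_cleanWalk` (`cleanWalk_of`). -/

/-- The arithmetic of one descent step: `C(ℓ,2)·A(ℓ/2) + (ℓ r + ℓ² + 1) ≤ A ℓ` for `ℓ ≥ 2`. -/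
theorem thresholdA_step {ℓ : ℕ} (hℓ : 2 ≤ ℓ) (r : ℕ) :
    ℓ.choose 2 * ((4 * (ℓ / 2) ^ 2) ^ (Nat.log 2 (ℓ / 2) + 1) * (r + 1)) + (ℓ * r + ℓ ^ 2 + 1)
      ≤ (4 * ℓ ^ 2) ^ (Nat.log 2 ℓ + 1) * (r + 1) := by
  set d : ℕ := Nat.log 2 ℓ with hd
  have hd1 : 1 ≤ d := Nat.log_pos one_lt_two hℓ
  have hdd : Nat.log 2 (ℓ / 2) + 1 = d := by
    rw [Nat.log_div_base]; omega
  rw [hdd]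
  have hL : 1 ≤ ℓ ^ 2 := Nat.one_le_pow _ _ (by omega)
  -- 4 (ℓ/2)^2 ≤ ℓ^2
  have h1 : 4 * (ℓ / 2) ^ 2 ≤ ℓ ^ 2 := by
    have e : 4 * (ℓ / 2) ^ 2 = (ℓ / 2 * 2) ^ 2 := by ring
    rw [e]
    exact Nat.pow_le_pow_left (Nat.div_mul_le_self ℓ 2) 2
  have hM : (4 * (ℓ / 2) ^ 2) ^ d * (r + 1) ≤ (ℓ ^ 2) ^ d * (r + 1) := by gcongr
  have hC : ℓ.choose 2 ≤ ℓ ^ 2 := by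
    rw [Nat.choose_two_right]
    calc ℓ * (ℓ - 1) / 2 ≤ ℓ * (ℓ - 1) := Nat.div_le_self _ _
      _ ≤ ℓ * ℓ := Nat.mul_le_mul_left _ (Nat.sub_le _ _)
      _ = ℓ ^ 2 := (sq ℓ).symm
  -- first term ≤ (ℓ²)^(d+1) (r+1)
  have hT1 : ℓ.choose 2 * ((4 * (ℓ / 2) ^ 2) ^ d * (r + 1)) ≤ (ℓ ^ 2) ^ (d + 1) * (r + 1) := by
    calc ℓ.choose 2 * ((4 * (ℓ / 2) ^ 2) ^ d * (r + 1)) ≤ ℓ ^ 2 * ((ℓ ^ 2) ^ d * (r + 1)) :=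
          Nat.mul_le_mul hC hM
      _ = (ℓ ^ 2) ^ (d + 1) * (r + 1) := by ring
  -- second term ≤ (ℓ²)^(d+1) (r+1)
  have hpow : ℓ ^ 2 * ℓ ^ 2 ≤ (ℓ ^ 2) ^ (d + 1) := by
    calc ℓ ^ 2 * ℓ ^ 2 = (ℓ ^ 2) ^ 2 := by ring
      _ ≤ (ℓ ^ 2) ^ (d + 1) := Nat.pow_le_pow_right hL (by omega)
  have hT2 : ℓ * r + ℓ ^ 2 + 1 ≤ (ℓ ^ 2) ^ (d + 1) * (r + 1) := by
    have h4 : 4 ≤ ℓ ^ 2 := by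
      calc 4 = 2 ^ 2 := by norm_num
        _ ≤ ℓ ^ 2 := Nat.pow_le_pow_left hℓ 2
    have hlL : ℓ ≤ ℓ ^ 2 := Nat.le_self_pow (by norm_num) ℓ
    have hr2 : r + 2 ≤ ℓ ^ 2 * (r + 1) :=
      calc r + 2 ≤ 4 * (r + 1) := by omega
        _ ≤ ℓ ^ 2 * (r + 1) := Nat.mul_le_mul_right _ h4
    have : ℓ * r + ℓ ^ 2 + 1 ≤ ℓ ^ 2 * ℓ ^ 2 * (r + 1) :=
      calc ℓ * r + ℓ ^ 2 + 1 ≤ ℓ ^ 2 * r + ℓ ^ 2 + ℓ ^ 2 :=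
            Nat.add_le_add (Nat.add_le_add (Nat.mul_le_mul_right r hlL) le_rfl) hL
        _ = ℓ ^ 2 * (r + 2) := by ring
        _ ≤ ℓ ^ 2 * (ℓ ^ 2 * (r + 1)) := Nat.mul_le_mul_left _ hr2
        _ = ℓ ^ 2 * ℓ ^ 2 * (r + 1) := by ring
    exact this.trans (Nat.mul_le_mul_right _ hpow)
  -- total ≤ 2 (ℓ²)^(d+1)(r+1) ≤ (4ℓ²)^(d+1)(r+1)
  have h2 : 2 * (ℓ ^ 2) ^ (d + 1) ≤ (4 * ℓ ^ 2) ^ (d + 1) := by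
    rw [mul_pow]
    apply Nat.mul_le_mul_right
    calc 2 ≤ 4 ^ 1 := by norm_num
      _ ≤ 4 ^ (d + 1) := Nat.pow_le_pow_right (by norm_num) (by omega)
  calc ℓ.choose 2 * ((4 * (ℓ / 2) ^ 2) ^ d * (r + 1)) + (ℓ * r + ℓ ^ 2 + 1)
      ≤ (ℓ ^ 2) ^ (d + 1) * (r + 1) + (ℓ ^ 2) ^ (d + 1) * (r + 1) := Nat.add_le_add hT1 hT2
    _ = (2 * (ℓ ^ 2) ^ (d + 1)) * (r + 1) := by ring
    _ ≤ (4 * ℓ ^ 2) ^ (d + 1) * (r + 1) := Nat.mul_le_mul_right _ h2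


end Summit.MatrixMultiplication.MatrixMultiplication.Theorems.HyperoctahedralThreshold.Refutation

/-- **`stub_refutationPoorCoreOf`** (registered sub-goal of stmt-MatrixMultiplication-10883): the poor core from the pattern-twin stub and
`stub_poorRigidCore` (skeleton glue `poorCore_of`). -/
theorem stub_refutationPoorCoreOf : Summit.MatrixMultiplication.MatrixMultiplication.Theorems.HyperoctahedralThreshold.Refutation.stub_patternTwin → Summit.MatrixMultiplication.MatrixMultiplication.Theorems.HyperoctahedralThreshold.Refutation.stub_poorRigidCore → Summit.MatrixMultiplication.MatrixMultiplication.Theorems.HyperoctahedralThreshold.Refutation.stub_poorCore :=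
  Summit.MatrixMultiplication.MatrixMultiplication.Theorems.HyperoctahedralThreshold.Refutation.poorCore_of
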